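import Summits.Ventures.CertifiedManyBodySolver.Observables.NeelClassExclusionCubic
import Summits.Ventures.CertifiedManyBodySolver.Observables.NeelClassExclusionCubicB
import Summits.Ventures.CertifiedManyBodySolver.Observables.NeelClassExclusionCubicDopingAxisU6
import Summits.Ventures.CertifiedManyBodySolver.Observables.NeelClassExclusionCubicDopingAxisU8
import Summits.Ventures.CertifiedManyBodySolver.Observables.NeelClassExclusionCubicWindows
import HarnessLib

/-!
# Ventures/CertifiedManyBodySolver — Observables/NeelClassExclusionCubicSummary.lean

HONEST FRAMING: first certified bounds; not a superconductivity verdict; every number certified or labelled float.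
A competing-order EXCLUSION removes a named class of candidate ground states; it never says which order is present;
no phase sentence follows.

Cell `hubbard-tc` (MO-S3, D-0096), seat `hubbard-tc-mod-3` (G3), `prover-hubbard-tc-mod-3-g8-0`. ONE KERNEL OBJECT PER COVERAGE
SENTENCE: the sixth-moment (cubic-majorant) window words of `NeelClassExclusionCubic*.lean` assembled by case analysis into the
three sentences the cell's TC-TABLE quotes for the AF item (Néel mean-field class = every state of an even torus with mean
density `n`, staggered magnetisation `m` and double occupancy `≥ (n²/4 − m²)L²`):

* `neelClassC_energy_ge_n78_Uaxis` — **at `(n, t′) = (7/8, 0)`, for EVERY `U ∈ [5, 17/2]`: energy per site `≥ e₀(1,0,U,7/8) + 1/100`**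
  (windows `[5, 21/4]` 1/100 · `[21/4, 11/2]` 7/200 · `[11/2, 6]` 3/50 · `[6, 13/2]` 3/100 · `[13/2, 8]` 3/50 · `[7, 17/2]` 1/10; caps #486 for
  `U ≤ 6`, #524 above, BY HYPOTHESIS); `neelClassC_energy_ge_n78_Uaxis_main` — for EVERY `U ∈ [21/4, 17/2]`: gap `≥ 3/100`;
* `neelClassC_energy_ge_U6_dopingAxis` — **at `(U, t′) = (6, 0)`, for EVERY `n ∈ [3/4, 1]` (hole doping 0–25 %): gap `≥ 1/50`**
  (bands 2/25 · 1/10 · 1/20 · 1/50; caps #523, #521, #486, #21);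
* `neelClassC_energy_ge_U8_dopingAxis` — **at `(U, t′) = (8, 0)`, for EVERY `n ∈ [3/4, 1]`: gap `≥ 1/40`** (bands 3/20 · 3/20 · 2/25 · 1/40;
  caps #450, #524, #472).

No new analysis: each theorem is `rcases` on the window + the landed window word. WHAT THIS IS NOT: a statement that
antiferromagnetic ORDER is absent; a statement about stripes, d-wave order or T_c; a phase word.

References: V. Bach, E. H. Lieb, J. P. Solovej, J. Stat. Phys. 76 (1994) 3, §2 eq. (2c.36) [BachLiebSolovej1994]; T. Koma, H. Tasaki, J. Stat.
Phys. 76 (1994) 745 §1 [KomaTasaki1994]; D. Ruelle (1969) §3.3 [Ruelle1969].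
-/

noncomputable section

namespace Summit.Ventures.CertifiedManyBodySolver.Observables

open Literature.MathematicalPhysics.QuantumLattice
open Literature.MathematicalPhysics.QuantumLattice.ThermodynamicLimit
open Summit.Ventures.CertifiedManyBodySolver.Certificates
open Matrix Finset Literature.Probability.LatticeModels
  Literature.MathematicalPhysics.QuantumLattice.RayleighBound
  Literature.MathematicalPhysics.QuantumLattice.LangerMattis
  Literature.MathematicalPhysics.QuantumLattice.HartreeFock
  NeelClassFloor
open scoped ComplexOrder

variable {L : ℕ} [NeZero L]

/-- **The `U`-axis at `(7/8, 0)`: for EVERY `U ∈ [5, 17/2]` the Néel mean-field class misses the ground-state energy density by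
`≥ 1/100·t` per site** (conditional BY HYPOTHESIS on the CERTIFIED caps #486 `cert_r486_qfp_U6_n7o8_tp0_upper` — read for `U ≤ 6` — and
#524 `cert_dbt299plaqRS_allk` — read for `U ≥ 6`; six sixth-moment window words; the minimum gap `1/100` is attained only on `[5, 21/4]`).
[cite: BachLiebSolovej1994, §2 eq. (2c.36)] [cite: KomaTasaki1994, §1] -/
theorem neelClassC_energy_ge_n78_Uaxis (h486 : cert_r486_qfp_U6_n7o8_tp0_upper) (hRS : cert_dbt299plaqRS_allk)
    {U : ℝ} (hU1 : 5 ≤ U) (hU2 : U ≤ 17 / 2) (hL : 7 ≤ L) (hLe : Even L) {m : ℝ}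
    {φ : Fock (Orb (FermionTorus 2 L))} (hφ : φ ≠ 0)
    (hN : (star φ ⬝ᵥ (totalNumber *ᵥ φ)).re = 7 / 8 * (L : ℝ) ^ 2 * normSq φ)
    (hO : (star φ ⬝ᵥ ((dGammaSpin 0 (stagMatrix 2 L) - dGammaSpin 1 (stagMatrix 2 L)) *ᵥ φ)).re =
      2 * m * (L : ℝ) ^ 2 * normSq φ)
    (hD : ((7 / 8 : ℝ) ^ 2 / 4 - m ^ 2) * (L : ℝ) ^ 2 * normSq φ ≤
      (star φ ⬝ᵥ ((∑ x : FermionTorus 2 L, numberOp x 0 * numberOp x 1) *ᵥ φ)).re) :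
    energyDensityTT' 1 0 U (7 / 8) + 1 / 100 ≤
      (star φ ⬝ᵥ (hubbardTorusTT' L 1 0 U *ᵥ φ)).re / ((L : ℝ) ^ 2 * normSq φ) := by
  rcases le_or_gt U (21 / 4) with h1 | h1
  · exact neelClassC_energy_ge_n78_Uwindow_5_525 h486 hU1 h1 hL hLe hφ hN hO hD
  rcases le_or_gt U (11 / 2) with h2 | h2
  · linarith [neelClassC_energy_ge_n78_Uwindow_525_55 h486 h1.le h2 hL hLe hφ hN hO hD]
  rcases le_or_gt U 6 with h3 | h3
  · linarith [neelClassC_energy_ge_n78_Uwindow_55_6 h486 h2.le h3 hL hLe hφ hN hO hD]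
  rcases le_or_gt U (13 / 2) with h4 | h4
  · linarith [neelClassC_energy_ge_n78_Uwindow_gapfill hRS h3.le h4 hL hLe hφ hN hO hD]
  rcases le_or_gt U 8 with h5 | h5
  · linarith [neelClassC_energy_ge_n78_Uwindow_mid hRS h4.le h5 hL hLe hφ hN hO hD]
  linarith [neelClassC_energy_ge_A0_Uwindow hRS (by linarith : (7 : ℝ) ≤ U) hU2 hL hLe hφ hN hO hD]

/-- **The `U`-axis at `(7/8, 0)`, main part: for EVERY `U ∈ [21/4, 17/2]` the gap is `≥ 3/100·t`** (caps #486 ∧ #524 BY HYPOTHESIS;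
windows 7/200 · 3/50 · 3/100 · 3/50 · 1/10). [cite: BachLiebSolovej1994, §2 eq. (2c.36)] [cite: KomaTasaki1994, §1] -/
theorem neelClassC_energy_ge_n78_Uaxis_main (h486 : cert_r486_qfp_U6_n7o8_tp0_upper) (hRS : cert_dbt299plaqRS_allk)
    {U : ℝ} (hU1 : 21 / 4 ≤ U) (hU2 : U ≤ 17 / 2) (hL : 7 ≤ L) (hLe : Even L) {m : ℝ}
    {φ : Fock (Orb (FermionTorus 2 L))} (hφ : φ ≠ 0)
    (hN : (star φ ⬝ᵥ (totalNumber *ᵥ φ)).re = 7 / 8 * (L : ℝ) ^ 2 * normSq φ)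
    (hO : (star φ ⬝ᵥ ((dGammaSpin 0 (stagMatrix 2 L) - dGammaSpin 1 (stagMatrix 2 L)) *ᵥ φ)).re =
      2 * m * (L : ℝ) ^ 2 * normSq φ)
    (hD : ((7 / 8 : ℝ) ^ 2 / 4 - m ^ 2) * (L : ℝ) ^ 2 * normSq φ ≤
      (star φ ⬝ᵥ ((∑ x : FermionTorus 2 L, numberOp x 0 * numberOp x 1) *ᵥ φ)).re) :
    energyDensityTT' 1 0 U (7 / 8) + 3 / 100 ≤
      (star φ ⬝ᵥ (hubbardTorusTT' L 1 0 U *ᵥ φ)).re / ((L : ℝ) ^ 2 * normSq φ) := by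
  rcases le_or_gt U (11 / 2) with h2 | h2
  · linarith [neelClassC_energy_ge_n78_Uwindow_525_55 h486 hU1 h2 hL hLe hφ hN hO hD]
  rcases le_or_gt U 6 with h3 | h3
  · linarith [neelClassC_energy_ge_n78_Uwindow_55_6 h486 h2.le h3 hL hLe hφ hN hO hD]
  rcases le_or_gt U (13 / 2) with h4 | h4
  · exact neelClassC_energy_ge_n78_Uwindow_gapfill hRS h3.le h4 hL hLe hφ hN hO hD
  rcases le_or_gt U 8 with h5 | h5
  · linarith [neelClassC_energy_ge_n78_Uwindow_mid hRS h4.le h5 hL hLe hφ hN hO hD]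
  linarith [neelClassC_energy_ge_A0_Uwindow hRS (by linarith : (7 : ℝ) ≤ U) hU2 hL hLe hφ hN hO hD]

/-- **The hole-doping axis at `(U, t′) = (6, 0)`: for EVERY `n ∈ [3/4, 1]` the Néel mean-field class misses `e₀(1,0,6,n)` by `≥ 1/50·t`**
(conditional BY HYPOTHESIS on the CERTIFIED caps #523, #521, #486, #21 read along density chords; bands 2/25 · 1/10 · 1/20 · 1/50 — the
minimum is attained only on `[19/20, 1]`). [cite: Ruelle1969, §3.3] [cite: BachLiebSolovej1994, §2 eq. (2c.36)] -/
theorem neelClassC_energy_ge_U6_dopingAxis (h523 : cert_r523_qfp_U6_n3o4_tp0_upper) (h521 : cert_r521_qfp_U6_n4o5_tp0_upper)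
    (h486 : cert_r486_qfp_U6_n7o8_tp0_upper) (h21 : cert_r21_luc_tl_upper_n1_U6) (hL : 7 ≤ L) (hLe : Even L)
    {n m : ℝ} (hn1 : 3 / 4 ≤ n) (hn2 : n ≤ 1) {φ : Fock (Orb (FermionTorus 2 L))} (hφ : φ ≠ 0)
    (hN : (star φ ⬝ᵥ (totalNumber *ᵥ φ)).re = n * (L : ℝ) ^ 2 * normSq φ)
    (hO : (star φ ⬝ᵥ ((dGammaSpin 0 (stagMatrix 2 L) - dGammaSpin 1 (stagMatrix 2 L)) *ᵥ φ)).re =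
      2 * m * (L : ℝ) ^ 2 * normSq φ)
    (hD : (n ^ 2 / 4 - m ^ 2) * (L : ℝ) ^ 2 * normSq φ ≤
      (star φ ⬝ᵥ ((∑ x : FermionTorus 2 L, numberOp x 0 * numberOp x 1) *ᵥ φ)).re) :
    energyDensityTT' 1 0 6 n + 1 / 50 ≤
      (star φ ⬝ᵥ (hubbardTorusTT' L 1 0 6 *ᵥ φ)).re / ((L : ℝ) ^ 2 * normSq φ) := by
  rcases le_or_gt n (4 / 5) with h1 | h1
  · linarith [neelClassC_energy_ge_U6_dopingBand_34_45 h523 h521 hL hLe hn1 h1 hφ hN hO hD]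
  rcases le_or_gt n (7 / 8) with h2 | h2
  · linarith [neelClassC_energy_ge_U6_dopingBand_45_78 h521 h486 hL hLe h1.le h2 hφ hN hO hD]
  rcases le_or_gt n (19 / 20) with h3 | h3
  · linarith [neelClassC_energy_ge_U6_dopingBand_78_1920 h486 h21 hL hLe h2.le h3 hφ hN hO hD]
  exact neelClassC_energy_ge_U6_dopingBand_1920_1 h486 h21 hL hLe h3.le hn2 hφ hN hO hD

/-- **The hole-doping axis at `(U, t′) = (8, 0)`: for EVERY `n ∈ [3/4, 1]` the Néel mean-field class misses `e₀(1,0,8,n)` by `≥ 1/40·t`**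
(conditional BY HYPOTHESIS on the CERTIFIED caps #450, #524, #472 read along density chords; bands 3/20 · 3/20 · 2/25 · 1/40 — the
minimum is attained only on `[19/20, 1]`; `≥ 2/25` for every hole doping `5–25 %`). [cite: Ruelle1969, §3.3] [cite: BachLiebSolovej1994, §2 eq. (2c.36)] -/
theorem neelClassC_energy_ge_U8_dopingAxis (h450 : cert_r450_openbox_32x4_U8_N96_tp0_D1400_b2) (hRS : cert_dbt299plaqRS_allk)
    (h472 : cert_r472_pb2_tl_upper_n1_U8) (hL : 7 ≤ L) (hLe : Even L)
    {n m : ℝ} (hn1 : 3 / 4 ≤ n) (hn2 : n ≤ 1) {φ : Fock (Orb (FermionTorus 2 L))} (hφ : φ ≠ 0)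
    (hN : (star φ ⬝ᵥ (totalNumber *ᵥ φ)).re = n * (L : ℝ) ^ 2 * normSq φ)
    (hO : (star φ ⬝ᵥ ((dGammaSpin 0 (stagMatrix 2 L) - dGammaSpin 1 (stagMatrix 2 L)) *ᵥ φ)).re =
      2 * m * (L : ℝ) ^ 2 * normSq φ)
    (hD : (n ^ 2 / 4 - m ^ 2) * (L : ℝ) ^ 2 * normSq φ ≤
      (star φ ⬝ᵥ ((∑ x : FermionTorus 2 L, numberOp x 0 * numberOp x 1) *ᵥ φ)).re) :
    energyDensityTT' 1 0 8 n + 1 / 40 ≤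
      (star φ ⬝ᵥ (hubbardTorusTT' L 1 0 8 *ᵥ φ)).re / ((L : ℝ) ^ 2 * normSq φ) := by
  rcases le_or_gt n (4 / 5) with h1 | h1
  · linarith [neelClassC_energy_ge_U8_dopingBand_34_45 h450 hRS hL hLe hn1 h1 hφ hN hO hD]
  rcases le_or_gt n (7 / 8) with h2 | h2
  · linarith [neelClassC_energy_ge_U8_dopingBand_45_78 h450 hRS hL hLe h1.le h2 hφ hN hO hD]
  rcases le_or_gt n (19 / 20) with h3 | h3
  · linarith [neelClassC_energy_ge_U8_dopingBand_78_1920 hRS h472 hL hLe h2.le h3 hφ hN hO hD]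
  exact neelClassC_energy_ge_U8_dopingBand_1920_1 hRS h472 hL hLe h3.le hn2 hφ hN hO hD

end Summit.Ventures.CertifiedManyBodySolver.Observables

end
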